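import Literature.NumberTheory.LFunctions.WeilExplicitContinuous
import Summits.RiemannHypothesis.RiemannHypothesis.Theorems.PfPersistenceGalerkinFormTests
import HarnessLib

/-!
# Mollification does not increase the `L²` norm: `∫‖(f ⋆ moll_k)(x)‖² dx ≤ ∫‖f(x)‖² dx` (PR/FIN input: `A′ ≤ A`, `B′ ≤ B`)

WEIL column (LADDER-RH, W-P(P2); tier-1 `ThetaCertificateSound`, item PR of THETA-ASSIGN §3/§6 Step 5: the arch bound D7
(`WeilColumnThetaArch`) is applied to the MOLLIFIED tail `T⁻ ⋆ moll_k`, whose `L²` norms must be bounded by those of `T⁻`).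
For `f` continuous with compact support and the tree mollifier `moll_k` (nonnegative, mass 1):
* `normSq_weilConv_moll_le` (Jensen by the variance identity): `‖(f⋆moll_k)(x)‖² ≤ ∫ ‖f(x−u)‖²·moll_k(u) du`;
* `integral_normSq_weilConv_moll_le`: `∫‖f⋆moll_k‖² ≤ ∫‖f‖²` (Fubini on a compactly supported continuous integrand).
RH-free; nothing here bears on the truth of RH.
-/

set_option linter.dupNamespace false

noncomputable section

open MeasureTheory Set Complex Filter
open Literature.NumberTheory.LFunctions Literature.NumberTheory.LFunctions.WeilContinuous

namespace Summit.RiemannHypothesis.RiemannHypothesis.Theorems.WeilColumn.ThetaMellin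

/-- **Variance form of Jensen (real)**: for a weight `w ≥ 0` with `∫ w = 1`, `(∫ G w)² ≤ ∫ G² w`. [folklore] -/
theorem sq_integral_mul_le {G w : ℝ → ℝ} (hw0 : ∀ u, 0 ≤ w u) (hw1 : ∫ u, w u = 1)
    (hGw : Integrable fun u => G u * w u) (hG2w : Integrable fun u => G u ^ 2 * w u) (hwi : Integrable w) :
    (∫ u, G u * w u) ^ 2 ≤ ∫ u, G u ^ 2 * w u := by
  set c : ℝ := ∫ u, G u * w u with hc
  have hexp : (fun u => (G u - c) ^ 2 * w u) = fun u => (G u ^ 2 * w u - 2 * c * (G u * w u)) + c ^ 2 * w u := by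
    funext u; ring
  have hnn : 0 ≤ ∫ u, (G u - c) ^ 2 * w u := integral_nonneg fun u => mul_nonneg (sq_nonneg _) (hw0 u)
  have hC : Integrable (fun u => 2 * c * (G u * w u)) := hGw.const_mul _
  have hA : Integrable (fun u => G u ^ 2 * w u - 2 * c * (G u * w u)) := hG2w.sub hC
  have hB : Integrable (fun u => c ^ 2 * w u) := hwi.const_mul _
  have hI : ∫ u, (G u - c) ^ 2 * w u = (∫ u, G u ^ 2 * w u) - 2 * c * c + c ^ 2 := by
    rw [hexp, integral_add hA hB, integral_sub hG2w hC, integral_const_mul, integral_const_mul, hw1, mul_one]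
  rw [hI] at hnn
  nlinarith

/-- **Jensen for a complex integrand**: `‖∫ F w‖² ≤ ∫ ‖F‖² w` (`w ≥ 0`, `∫ w = 1`). [folklore] -/
theorem normSq_integral_mul_le {F : ℝ → ℂ} {w : ℝ → ℝ} (hw0 : ∀ u, 0 ≤ w u) (hw1 : ∫ u, w u = 1)
    (hFw : Integrable fun u => F u * (w u : ℂ)) (hF2w : Integrable fun u => ‖F u‖ ^ 2 * w u)
    (hwi : Integrable w) :
    ‖∫ u, F u * (w u : ℂ)‖ ^ 2 ≤ ∫ u, ‖F u‖ ^ 2 * w u := by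
  have hnorm : ∀ u, ‖F u * (w u : ℂ)‖ = ‖F u‖ * w u := fun u => by
    rw [norm_mul, Complex.norm_real, Real.norm_of_nonneg (hw0 u)]
  have h1 : ‖∫ u, F u * (w u : ℂ)‖ ≤ ∫ u, ‖F u‖ * w u := by
    refine (norm_integral_le_integral_norm _).trans (le_of_eq ?_)
    exact integral_congr_ae (Eventually.of_forall hnorm)
  have hGw : Integrable fun u => ‖F u‖ * w u := hFw.norm.congr (Eventually.of_forall hnorm)
  have h2 := sq_integral_mul_le hw0 hw1 hGw hF2w hwi
  have h0 : 0 ≤ ∫ u, ‖F u‖ * w u := integral_nonneg fun u => mul_nonneg (norm_nonneg _) (hw0 u)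
  calc ‖∫ u, F u * (w u : ℂ)‖ ^ 2 ≤ (∫ u, ‖F u‖ * w u) ^ 2 := pow_le_pow_left₀ (norm_nonneg _) h1 2
    _ ≤ ∫ u, ‖F u‖ ^ 2 * w u := h2

/-- **Jensen for the mollifier**: `‖(f ⋆ moll_k)(x)‖² ≤ ∫ ‖f(x−u)‖²·moll_k(u) du` for `f` continuous. [folklore] -/
theorem normSq_weilConv_moll_le {f : ℝ → ℂ} (hf : Continuous f) (k : ℕ) (x : ℝ) :
    ‖weilConv f (moll k) x‖ ^ 2 ≤ ∫ u, ‖f (x - u)‖ ^ 2 * (bump k).normed volume u := by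
  -- rewrite the convolution as ∫ f(x−u) moll(u) du
  have hconv : weilConv f (moll k) x = ∫ u, f (x - u) * (((bump k).normed volume u : ℝ) : ℂ) := by
    rw [weilConv_apply]
    have h := integral_sub_left_eq_self (fun u => f u * moll k (x - u)) volume x
    rw [← h]
    refine integral_congr_ae (Eventually.of_forall fun u => ?_)
    simp only [sub_sub_cancel]
    rfl
  rw [hconv]
  have hmc : Continuous fun u => (bump k).normed volume u := (bump k).continuous_normed
  have hms : HasCompactSupport fun u => (bump k).normed volume u := (bump k).hasCompactSupport_normed
  have hfc : Continuous fun u => f (x - u) := hf.comp (continuous_const.sub continuous_id)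
  refine normSq_integral_mul_le (fun u => (bump k).nonneg_normed u) ((bump k).integral_normed) ?_ ?_ ?_
  · exact (hfc.mul (Complex.continuous_ofReal.comp hmc)).integrable_of_hasCompactSupport (hms.comp_left (g := fun r : ℝ => (r : ℂ)) rfl |>.mul_left)
  · exact ((hfc.norm.pow 2).mul hmc).integrable_of_hasCompactSupport hms.mul_left
  · exact hmc.integrable_of_hasCompactSupport hms

/-- **`∫‖f ⋆ moll_k‖² ≤ ∫‖f‖²`** for `f` continuous with compact support. [folklore] -/
theorem integral_normSq_weilConv_moll_le {f : ℝ → ℂ} (hf : Continuous f) (hfs : HasCompactSupport f) (k : ℕ) :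
    ∫ x, ‖weilConv f (moll k) x‖ ^ 2 ≤ ∫ x, ‖f x‖ ^ 2 := by
  set w : ℝ → ℝ := fun u => (bump k).normed volume u with hw
  have hmc : Continuous w := (bump k).continuous_normed
  have hms : HasCompactSupport w := (bump k).hasCompactSupport_normed
  -- the joint integrand (x,u) ↦ ‖f(x−u)‖² w(u) is continuous with compact support on ℝ × ℝ
  set F : ℝ × ℝ → ℝ := fun p => ‖f (p.1 - p.2)‖ ^ 2 * w p.2 with hF
  have hFc : Continuous F := by
    have h1 : Continuous fun p : ℝ × ℝ => f (p.1 - p.2) := hf.comp (continuous_fst.sub continuous_snd)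
    exact (h1.norm.pow 2).mul (hmc.comp continuous_snd)
  have hFs : HasCompactSupport F := by
    obtain ⟨Rf, hRf⟩ := hfs.isCompact.isBounded.subset_closedBall 0
    obtain ⟨Rw, hRw⟩ := hms.isCompact.isBounded.subset_closedBall 0
    refine HasCompactSupport.of_support_subset_isCompact
      ((isCompact_closedBall (0 : ℝ) (Rf + Rw)).prod (isCompact_closedBall (0 : ℝ) Rw)) fun p hp => ?_
    have hp' : f (p.1 - p.2) ≠ 0 ∧ w p.2 ≠ 0 := by
      simpa [hF, mul_eq_zero, pow_eq_zero_iff, norm_eq_zero, not_or] using hp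
    have h2 : p.2 ∈ Metric.closedBall (0 : ℝ) Rw := hRw (subset_tsupport _ (Function.mem_support.mpr hp'.2))
    have h1 : p.1 - p.2 ∈ Metric.closedBall (0 : ℝ) Rf := hRf (subset_tsupport _ (Function.mem_support.mpr hp'.1))
    refine ⟨?_, h2⟩
    rw [Metric.mem_closedBall, dist_zero_right, Real.norm_eq_abs] at h1 h2 ⊢
    have := abs_add_le (p.1 - p.2) p.2
    rw [sub_add_cancel] at this
    linarith
  have hFi : Integrable F (volume.prod volume) := hFc.integrable_of_hasCompactSupport hFs
  -- pointwise Jensen, then integrate and swap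
  have hpt : ∀ x, ‖weilConv f (moll k) x‖ ^ 2 ≤ ∫ u, F (x, u) := fun x => normSq_weilConv_moll_le hf k x
  calc ∫ x, ‖weilConv f (moll k) x‖ ^ 2 ≤ ∫ x, ∫ u, F (x, u) := by
        exact integral_mono_of_nonneg (Eventually.of_forall fun x => by positivity) hFi.integral_prod_left
          (Eventually.of_forall hpt)
    _ = ∫ u, ∫ x, F (x, u) := integral_integral_swap hFi
    _ = ∫ u, (∫ x, ‖f x‖ ^ 2) * w u := by
        refine integral_congr_ae (Eventually.of_forall fun u => ?_)
        simp only [hF]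
        rw [integral_mul_const, integral_sub_right_eq_self (fun x => ‖f x‖ ^ 2) u]
    _ = ∫ x, ‖f x‖ ^ 2 := by rw [integral_const_mul, (bump k).integral_normed, mul_one]

end Summit.RiemannHypothesis.RiemannHypothesis.Theorems.WeilColumn.ThetaMellin
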